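import Mathlib
import Summits.QuantumFields.YangMills.Theorems.UnitScaleTiltHistoryTailBoundedHeight
import Literature.MathematicalPhysics.QuantumFieldTheory.Balaban1983to89.T3AveragedTailProfile

/-!
# Route `SmallFieldWidening` — crux r3 `LargeFieldMassRefinementTail` (stmt-QuantumFields-22884), line `birth`: THE ELEMENTARY ENVELOPE of the
# block-averaged large-field tail, file 1 of 3: the explicit elementary bound at EVERY height, and its height-free form on the logarithmic-height
# region `((151L²)^j)² ≤ p(g_{K−j})` (support file, instrument row; the stub `stub_avgTailPkg` and the crux stay open)

Width seat `ym-line-sfw-p2-w2` (gen 4), 2026-08-28.  The ONE registered stub of the line is `stub_avgTailPkg` (= `T3BareTailProfile.AveragedTailAt`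
for every family of block size `L`: a summable profile `q` with `Gibbs_K{U : ¬PlaqSmall θ(K−j) (Ū^{j})} ≤ q(K−j)` for ALL cut-offs `K` and ALL
heights `1 ≤ j ≤ K`), the K2 frontier of route `UnitScaleTilt` (Bałaban's (α) representation).  Two ELEMENTARY regions of the `(K, j)`-plane are in
the tree: bounded heights `j ≤ j₀` (`HistoryTailBoundedHeight.unitScaleTilt_perPlaquette_boundedHeight`, constants degrading like `(151L²)^{2j₀}`) and
bounded runs `K ≤ J` (`…BoundedRuns`).  THIS FILE proves the estimate on the whole **elementary envelope**

  `E = {(K, j) : j ≤ K, ((151L²)^j)² ≤ p(g_{K−j})}`,   `p = B10.pFun b₀ p₀`, `g_i = √(γL^{−i})`,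

with ONE profile `q(i) = A·2^{−i}` (for `0 < γ ≤ 1`, `0 < b₀`, `2 ≤ p₀`), uniformly in `K`, the height and the volume.  THIS FILE:

* §1 `gibbsK_real_not_plaqSmall_iter_le` — ALL heights, explicit: `Gibbs_K{¬PlaqSmall θ(K−j) (Ū^{j})} ≤
  144e^{24}c₀^{−3}L^{3m}·(L^j)^8·β_{K−j}^8·exp(−L^j p(g_{K−j})²/(4((151L²)^j)²))` (crude Prop 1 for (0.4) iterated `j` times — the height-`j`
  large-plaquette event lies in the FINE large-field event of radius `θ(K−j)/(151L²)^j` — and the finest-height reflection-positivity /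
  chessboard tail at that radius, union bound over the fine plaquettes; `β_K = L^jβ_{K−j}`, `β_{K−j}θ(K−j)² = p(g_{K−j})²`);
* §2 on `E` the exponent is `≥ p(g_{K−j})/4` and `(L^j)^8 ≤ p(g_{K−j})²`, so the bound is `≤ A₀·β_i^8·p(g_i)²·e^{−p(g_i)/4}`, `i = K − j`;

SEQUELS: `…ElementaryEnvelopeProfile` (§3 the per-height arithmetic and ONE summable profile on the whole of `E` — `averagedTail_on_envelope`;
§4 `averagedTailAt_of_offEnvelope`: `AveragedTailAt` ⇐ ANY profile for the heights OFF `E`, so the located open content of `stub_avgTailPkg` is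
EXACTLY the super-logarithmic heights; §5 the reach of `E`: monotone in `j`, eventually containing every fixed height, logarithmic reading) and
`…ElementaryEnvelopeCrux` (§6 r3's free-top-steps currency on `E`, unconditionally; §7 the crux BY NAME from the heights off `E`).

WHY ONLY LOGARITHMIC HEIGHTS (recorded, not formalised): every elementary route — deterministic propagation of fine smallness (this file),
chessboard at height `j` with a thermodynamic splitting `e^{−βS} = e^{−λβS}e^{−(1−λ)βS}`, energy inclusion — pays an entropy `∝ L^{3j}` per
averaging cell against the energy `p(g_{K−j})²` of one large averaged plaquette, so it closes exactly when `L^{O(j)} ≲ p(g_{K−j})`, i.e. `j ≲ log(K−j)`;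
beyond that the per-cell normalisation must be known to relative accuracy `o(p²/L^{3j})` across `j` scales — Bałaban's renormalisation-group
representation ([Balaban1985UV3] (41)/(71)), the content of the K2 frontier `AlphaInputsT3ACv3RecChi`.  NOTHING here uses (α); the crux r3, the stub
and route `SmallFieldWidening` stay open/conditional.  No summit is proved (rung R3 record; the YM mass gap is NOT touched).

References: T. Bałaban, CMP **102** (1985) 255–275 [Balaban1985UV3] ((7) p.257, (11) p.258, (71) p.273); CMP **98** (1985) 17–51
[Balaban1985Averaging] (Prop. 1 (51) p.26).
-/

noncomputable section

namespace Summit.QuantumFields.YangMills.Theorems.LargeFieldMassRefinementTailElementaryEnvelope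

open MeasureTheory
open scoped BigOperators
open Literature.MathematicalPhysics.QuantumFieldTheory (Plaquette)
open Literature.MathematicalPhysics.QuantumFieldTheory.Balaban1983to89
open Literature.MathematicalPhysics.QuantumFieldTheory.Balaban1983to89.T3ContinuumYM3Torus
open Literature.MathematicalPhysics.QuantumFieldTheory.Balaban1983to89.T3UnitScaleTilt
open Literature.MathematicalPhysics.QuantumFieldTheory.Balaban1983to89.T3UnitLawDensityEML
open Literature.MathematicalPhysics.QuantumFieldTheory.Balaban1983to89.T3CruxEstimates
open Literature.MathematicalPhysics.QuantumFieldTheory.Balaban1983to89.T3FinestHeightTail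
open Literature.MathematicalPhysics.QuantumFieldTheory.Balaban1983to89.T3BareTailProfile
open Literature.MathematicalPhysics.QuantumFieldTheory.Balaban1983to89.T4PairDerivBridge (dist1_le_two_specialUnitaryGroup)
open Literature.MathematicalPhysics.QuantumFieldTheory.Balaban1983to89.T3UpperLiftSplit (scheme_β_eq)
open Summit.QuantumFields.YangMills.Theorems.HistoryTailBoundedHeight

/-! ## §1 All heights: the explicit elementary bound -/

section AllHeights

variable (F : T3Family)

/-- **THE HEIGHT-`j` LARGE-FIELD EVENT LIES IN THE FINE LARGE-FIELD EVENT OF RADIUS `θ/(151L²)^j`** (`0 ≤ θ ≤ 2`, `j ≤ K`): if SOME plaquette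
of the `j`-fold (0.4)-averaged field is `θ`-large then some fine plaquette is `θ/(151L²)^j`-large (crude Prop 1 iterated, contrapositive;
the plaquette-free form of `HistoryTailBoundedHeight.event_subset_not_plaqSmall`). [cite: Balaban1985Averaging, Prop. 1 (51) p.26] -/
theorem not_plaqSmall_iter_subset {K j : ℕ} (hjK : j ≤ K) {θ : ℝ} (hθ0 : 0 ≤ θ) (hθ2 : θ ≤ 2) :
    {U : GaugeField (F.P K) 0 (Matrix.specialUnitaryGroup (Fin 2) ℂ) |
        ¬ PlaqSmall θ (Averaging.iter (fun i => BlockAveraging.blockAvg (P := F.P K) (j := i) ℰp) j U)} ⊆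
      {U | ¬ PlaqSmall (θ / (151 * (F.L : ℝ) ^ 2) ^ j) U} := by
  intro U hU
  simp only [Set.mem_setOf_eq, PlaqSmall, not_forall, not_lt] at hU
  obtain ⟨p, hp⟩ := hU
  exact event_subset_not_plaqSmall F hjK hθ0 hθ2 p hp

/-- **THE ELEMENTARY BOUND AT EVERY HEIGHT** (`0 < γ ≤ 1`, `0 ≤ b₀`, any `p₀`, every cut-off `K` and height `j ≤ K`):
`Gibbs_K{U : ¬PlaqSmall θ(K−j) (Ū^{j})} ≤ 144e^{24}c₀^{−3}·L^{3m}·(L^j)^8·β_{K−j}^8·exp(−L^j·p(g_{K−j})²/(4·((151L²)^j)²))` — §1's inclusion, the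
finest-height reflection-positivity/chessboard tail at radius `θ(K−j)/(151L²)^j` with the union bound over the `≤ 72L^{3(m+K)}` fine plaquettes
(`HistoryTailBoundedHeight.gibbsK_real_not_plaqSmall_le_of_radius`), and the arithmetic `β_K = L^jβ_{K−j}`, `β_{K−j}θ(K−j)² = p(g_{K−j})²`,
`L^{K−j} ≤ β_{K−j}`.  The Gaussian exponent degrades geometrically in the height: this is the whole elementary reach.
[cite: Balaban1985UV3, (7) p.257, (11) p.258 and (71) p.273; Balaban1985Averaging, Prop. 1 (51) p.26] -/
theorem gibbsK_real_not_plaqSmall_iter_le :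
    ∃ c₀ : ℝ, 0 < c₀ ∧ c₀ ≤ 1 ∧ ∀ (F : T3Family) (γ : ℝ), 0 < γ → γ ≤ 1 → ∀ (b₀ p₀ : ℝ), 0 ≤ b₀ →
      ∀ (K j : ℕ), j ≤ K →
        (gibbsK F ℰp γ K).real
            {U | ¬ PlaqSmall (θBal F.L γ b₀ p₀ (K - j))
              (Averaging.iter (fun i => BlockAveraging.blockAvg (P := F.P K) (j := i) ℰp) j U)} ≤
          (144 * Real.exp 24 * (c₀ ^ 3)⁻¹ * (F.L : ℝ) ^ (3 * F.m)) * ((F.L : ℝ) ^ j) ^ 8 *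
            (F.scheme ℰp γ).β (K - j) ^ 8 *
              Real.exp (-((F.L : ℝ) ^ j * B10.pFun b₀ p₀ (Real.sqrt (γ * ((F.L : ℝ)⁻¹) ^ (K - j))) ^ 2 /
                (4 * ((151 * (F.L : ℝ) ^ 2) ^ j) ^ 2))) := by
  obtain ⟨c₀, hc₀, hc₀1, htail⟩ := gibbsK_real_not_plaqSmall_le_of_radius
  refine ⟨c₀, hc₀, hc₀1, fun F γ hγ hγ1 b₀ p₀ hb₀ K j hjK => ?_⟩
  have hL1 : (1 : ℝ) ≤ F.L := by exact_mod_cast F.hL.2.le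
  have hL0 : (0 : ℝ) < F.L := by positivity
  have hΛ0 := lam_pos F
  -- names
  set i : ℕ := K - j with hi
  have hK : K = i + j := by omega
  set βi : ℝ := (F.scheme ℰp γ).β i with hβi
  set βK : ℝ := (F.scheme ℰp γ).β K with hβK
  set θ : ℝ := θBal F.L γ b₀ p₀ i with hθ
  set pg : ℝ := B10.pFun b₀ p₀ (Real.sqrt (γ * ((F.L : ℝ)⁻¹) ^ i)) with hpg
  have hβKeq : βK = (F.L : ℝ) ^ j * βi := by rw [hβK, hK, scheme_β_add]
  have hβi1 : 1 ≤ βi := one_le_scheme_β F hγ hγ1 i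
  have hβK1 : 1 ≤ βK := one_le_scheme_β F hγ hγ1 K
  have hθ0 : 0 ≤ θ := θBal_nonneg' F hγ hγ1 hb₀ p₀ i
  have hLj1 : (1 : ℝ) ≤ (F.L : ℝ) ^ j := one_le_pow₀ hL1
  have hβθ : βi * θ ^ 2 = pg ^ 2 := beta_mul_θBal_sq F hγ b₀ p₀ i
  -- the right-hand side is non-negative
  have hRHS0 : 0 ≤ (144 * Real.exp 24 * (c₀ ^ 3)⁻¹ * (F.L : ℝ) ^ (3 * F.m)) * ((F.L : ℝ) ^ j) ^ 8 * βi ^ 8 *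
      Real.exp (-((F.L : ℝ) ^ j * pg ^ 2 / (4 * ((151 * (F.L : ℝ) ^ 2) ^ j) ^ 2))) := by positivity
  -- trivial case `θ > 2`: the event is empty (`dist1 ≤ 2` on `SU(2)`)
  by_cases hθ2 : 2 < θ
  · have hempty : {U : GaugeField (F.P K) 0 (Matrix.specialUnitaryGroup (Fin 2) ℂ) |
        ¬ PlaqSmall θ (Averaging.iter (fun i => BlockAveraging.blockAvg (P := F.P K) (j := i) ℰp) j U)} = ∅ := by
      ext U
      simp only [Set.mem_setOf_eq, Set.mem_empty_iff_false, iff_false, not_not]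
      exact fun p => (dist1_le_two_specialUnitaryGroup _).trans_lt hθ2
    rw [hempty, measureReal_empty]
    exact hRHS0
  rw [not_lt] at hθ2
  -- main case: the event lies in the fine large-field event of radius `a = θ/Λ^j`
  set a : ℝ := θ / (151 * (F.L : ℝ) ^ 2) ^ j with ha
  have hΛj0 : 0 < (151 * (F.L : ℝ) ^ 2) ^ j := pow_pos hΛ0 j
  have ha0 : 0 ≤ a := div_nonneg hθ0 hΛj0.le
  haveI := isProbabilityMeasure_gibbsK F ℰp hγ.le K
  have hsub := not_plaqSmall_iter_subset F hjK hθ0 hθ2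
  have hmono : (gibbsK F ℰp γ K).real
      {U | ¬ PlaqSmall θ (Averaging.iter (fun i => BlockAveraging.blockAvg (P := F.P K) (j := i) ℰp) j U)} ≤
      (gibbsK F ℰp γ K).real {U | ¬ PlaqSmall a U} :=
    measureReal_mono hsub (measure_ne_top _ _)
  refine hmono.trans ((htail F γ hγ K a ha0 hβK1).trans ?_)
  -- (i) the number of fine plaquettes: `≤ 72 L^{3m} (L^j)^3 (L^i)^3 ≤ 72 L^{3m} (L^j)^3 βi³`
  have hsites : ((F.P K).sitesPerDir 0 : ℝ) = 2 * (F.L : ℝ) ^ (F.m + K) := by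
    rw [show (F.P K).sitesPerDir 0 = 2 * F.L ^ (F.m + K - 0) from rfl, Nat.sub_zero]; push_cast; ring
  have hcard : (Fintype.card (Plaq (F.P K) 0) : ℝ) ≤ 72 * (F.L : ℝ) ^ (3 * F.m) * ((F.L : ℝ) ^ j) ^ 3 * βi ^ 3 := by
    refine (card_plaq_le F K 0).trans ?_
    rw [hsites, hK]
    have hLi : ((F.L : ℝ) ^ i) ^ 3 ≤ βi ^ 3 := by
      gcongr
      exact pow_le_scheme_β F hγ hγ1 i
    calc 9 * (2 * (F.L : ℝ) ^ (F.m + (i + j))) ^ 3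
        = 72 * ((F.L : ℝ) ^ F.m) ^ 3 * ((F.L : ℝ) ^ j) ^ 3 * ((F.L : ℝ) ^ i) ^ 3 := by rw [pow_add, pow_add]; ring
      _ ≤ 72 * ((F.L : ℝ) ^ F.m) ^ 3 * ((F.L : ℝ) ^ j) ^ 3 * βi ^ 3 := by gcongr
      _ = 72 * (F.L : ℝ) ^ (3 * F.m) * ((F.L : ℝ) ^ j) ^ 3 * βi ^ 3 := by rw [← pow_mul, mul_comm F.m 3]
  -- (ii) the polynomial prefactor: `(√βK)^9 ≤ βK^5 = (L^j)^5 βi^5`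
  have hsqrt : Real.sqrt βK ^ 9 ≤ ((F.L : ℝ) ^ j) ^ 5 * βi ^ 5 := by
    have hs1 : 1 ≤ Real.sqrt βK := by rw [← Real.sqrt_one]; exact Real.sqrt_le_sqrt hβK1
    have h9 : Real.sqrt βK ^ 9 ≤ Real.sqrt βK ^ 10 := pow_le_pow_right₀ hs1 (by norm_num)
    have h10 : Real.sqrt βK ^ 10 = βK ^ 5 := by
      rw [show (10 : ℕ) = 2 * 5 from rfl, pow_mul, Real.sq_sqrt (zero_le_one.trans hβK1)]
    refine h9.trans (le_of_eq ?_)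
    rw [h10, hβKeq, mul_pow]
  -- (iii) the Gaussian factor: `βK a²/4 = L^j p²/(4Λ^{2j})`
  have hgauss : Real.exp (-(βK * a ^ 2 / 4)) =
      Real.exp (-((F.L : ℝ) ^ j * pg ^ 2 / (4 * ((151 * (F.L : ℝ) ^ 2) ^ j) ^ 2))) := by
    congr 2
    rw [ha, hβKeq, div_pow, ← hβθ]
    field_simp
  -- assemble
  rw [hgauss]
  calc (Fintype.card (Plaq (F.P K) 0) : ℝ) *
        (2 * Real.exp 24 * (c₀ ^ 3)⁻¹ * Real.sqrt βK ^ 9 *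
          Real.exp (-((F.L : ℝ) ^ j * pg ^ 2 / (4 * ((151 * (F.L : ℝ) ^ 2) ^ j) ^ 2))))
      ≤ (72 * (F.L : ℝ) ^ (3 * F.m) * ((F.L : ℝ) ^ j) ^ 3 * βi ^ 3) *
        (2 * Real.exp 24 * (c₀ ^ 3)⁻¹ * (((F.L : ℝ) ^ j) ^ 5 * βi ^ 5) *
          Real.exp (-((F.L : ℝ) ^ j * pg ^ 2 / (4 * ((151 * (F.L : ℝ) ^ 2) ^ j) ^ 2)))) := by
        gcongr
    _ = (144 * Real.exp 24 * (c₀ ^ 3)⁻¹ * (F.L : ℝ) ^ (3 * F.m)) * ((F.L : ℝ) ^ j) ^ 8 * βi ^ 8 *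
          Real.exp (-((F.L : ℝ) ^ j * pg ^ 2 / (4 * ((151 * (F.L : ℝ) ^ 2) ^ j) ^ 2))) := by ring

end AllHeights

/-! ## §2 On the envelope: the exponent is at least `p/4` and the height prefactor is at most `p²` -/

section Envelope

variable (F : T3Family)

/-- `L² ≤ 151L²`, hence `(L^j)² ≤ (151L²)^j`. [folklore] -/
theorem pow_sq_le_lam_pow (j : ℕ) : ((F.L : ℝ) ^ j) ^ 2 ≤ (151 * (F.L : ℝ) ^ 2) ^ j := by
  rw [← pow_mul, mul_comm, pow_mul]
  exact pow_le_pow_left₀ (by positivity) (by nlinarith [sq_nonneg (F.L : ℝ)]) j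

/-- On the envelope `((151L²)^j)² ≤ p` the height prefactor is absorbed: `(L^j)^8 ≤ p²`. [folklore] -/
theorem pow_eight_le_sq_of_envelope (j : ℕ) {p : ℝ} (henv : ((151 * (F.L : ℝ) ^ 2) ^ j) ^ 2 ≤ p) :
    ((F.L : ℝ) ^ j) ^ 8 ≤ p ^ 2 := by
  have h0 : 0 ≤ ((151 * (F.L : ℝ) ^ 2) ^ j) ^ 2 := by positivity
  calc ((F.L : ℝ) ^ j) ^ 8 = (((F.L : ℝ) ^ j) ^ 2) ^ 4 := by ring
    _ ≤ ((151 * (F.L : ℝ) ^ 2) ^ j) ^ 4 := pow_le_pow_left₀ (by positivity) (pow_sq_le_lam_pow F j) 4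
    _ = (((151 * (F.L : ℝ) ^ 2) ^ j) ^ 2) ^ 2 := by ring
    _ ≤ p ^ 2 := pow_le_pow_left₀ h0 henv 2

/-- On the envelope `((151L²)^j)² ≤ p` the Gaussian exponent dominates a LINEAR one: `p/4 ≤ L^j·p²/(4·((151L²)^j)²)`. [folklore] -/
theorem quarter_le_exponent_of_envelope (j : ℕ) {p : ℝ} (henv : ((151 * (F.L : ℝ) ^ 2) ^ j) ^ 2 ≤ p) :
    p / 4 ≤ (F.L : ℝ) ^ j * p ^ 2 / (4 * ((151 * (F.L : ℝ) ^ 2) ^ j) ^ 2) := by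
  have hL1 : (1 : ℝ) ≤ F.L := by exact_mod_cast F.hL.2.le
  have hΛ2 : 0 < ((151 * (F.L : ℝ) ^ 2) ^ j) ^ 2 := by positivity
  have hp0 : 0 < p := lt_of_lt_of_le hΛ2 henv
  have hLj1 : (1 : ℝ) ≤ (F.L : ℝ) ^ j := one_le_pow₀ hL1
  rw [div_le_div_iff₀ (by norm_num) (by positivity)]
  -- `p · (4 Λ²) ≤ (L^j p²) · 4`
  calc p * (4 * ((151 * (F.L : ℝ) ^ 2) ^ j) ^ 2) = 4 * (p * ((151 * (F.L : ℝ) ^ 2) ^ j) ^ 2) := by ring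
    _ ≤ 4 * (p * p) := by gcongr
    _ = 1 * p ^ 2 * 4 := by ring
    _ ≤ (F.L : ℝ) ^ j * p ^ 2 * 4 := by gcongr

/-- **THE ELEMENTARY BOUND ON THE ENVELOPE**: for `(K, j)` with `j ≤ K` and `((151L²)^j)² ≤ p(g_{K−j})`,
`Gibbs_K{¬PlaqSmall θ(K−j) (Ū^{j})} ≤ A₀·β_{K−j}^8·(p(g_{K−j})²·e^{−p(g_{K−j})/4})`, `A₀ = 144e^{24}c₀^{−3}L^{3m}` — the height has disappeared
from the right-hand side. [cite: Balaban1985UV3, (7) p.257 and (71) p.273; Balaban1985Averaging, Prop. 1 (51) p.26] -/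
theorem gibbsK_real_not_plaqSmall_iter_le_of_envelope :
    ∃ c₀ : ℝ, 0 < c₀ ∧ c₀ ≤ 1 ∧ ∀ (F : T3Family) (γ : ℝ), 0 < γ → γ ≤ 1 → ∀ (b₀ p₀ : ℝ), 0 ≤ b₀ →
      ∀ (K j : ℕ), j ≤ K →
        ((151 * (F.L : ℝ) ^ 2) ^ j) ^ 2 ≤ B10.pFun b₀ p₀ (Real.sqrt (γ * ((F.L : ℝ)⁻¹) ^ (K - j))) →
        (gibbsK F ℰp γ K).real
            {U | ¬ PlaqSmall (θBal F.L γ b₀ p₀ (K - j))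
              (Averaging.iter (fun i => BlockAveraging.blockAvg (P := F.P K) (j := i) ℰp) j U)} ≤
          (144 * Real.exp 24 * (c₀ ^ 3)⁻¹ * (F.L : ℝ) ^ (3 * F.m)) * (F.scheme ℰp γ).β (K - j) ^ 8 *
            (B10.pFun b₀ p₀ (Real.sqrt (γ * ((F.L : ℝ)⁻¹) ^ (K - j))) ^ 2 *
              Real.exp (-(B10.pFun b₀ p₀ (Real.sqrt (γ * ((F.L : ℝ)⁻¹) ^ (K - j))) / 4))) := by
  obtain ⟨c₀, hc₀, hc₀1, hall⟩ := gibbsK_real_not_plaqSmall_iter_le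
  refine ⟨c₀, hc₀, hc₀1, fun F γ hγ hγ1 b₀ p₀ hb₀ K j hjK henv => ?_⟩
  refine (hall F γ hγ hγ1 b₀ p₀ hb₀ K j hjK).trans ?_
  set pg : ℝ := B10.pFun b₀ p₀ (Real.sqrt (γ * ((F.L : ℝ)⁻¹) ^ (K - j))) with hpg
  set A₀ : ℝ := 144 * Real.exp 24 * (c₀ ^ 3)⁻¹ * (F.L : ℝ) ^ (3 * F.m) with hA₀
  have hA₀0 : 0 ≤ A₀ := by positivity
  have hβ0 : 0 ≤ (F.scheme ℰp γ).β (K - j) ^ 8 := pow_nonneg (F.scheme_β_nonneg ℰp hγ.le (K - j)) 8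
  have hpoly := pow_eight_le_sq_of_envelope F j henv
  have hexp : Real.exp (-((F.L : ℝ) ^ j * pg ^ 2 / (4 * ((151 * (F.L : ℝ) ^ 2) ^ j) ^ 2))) ≤ Real.exp (-(pg / 4)) :=
    Real.exp_le_exp.mpr (neg_le_neg (quarter_le_exponent_of_envelope F j henv))
  calc A₀ * ((F.L : ℝ) ^ j) ^ 8 * (F.scheme ℰp γ).β (K - j) ^ 8 *
        Real.exp (-((F.L : ℝ) ^ j * pg ^ 2 / (4 * ((151 * (F.L : ℝ) ^ 2) ^ j) ^ 2)))
      ≤ A₀ * pg ^ 2 * (F.scheme ℰp γ).β (K - j) ^ 8 * Real.exp (-(pg / 4)) := by gcongr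
    _ = A₀ * (F.scheme ℰp γ).β (K - j) ^ 8 * (pg ^ 2 * Real.exp (-(pg / 4))) := by ring

end Envelope

end Summit.QuantumFields.YangMills.Theorems.LargeFieldMassRefinementTailElementaryEnvelope

end
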